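import Mathlib
import Literature.Probability.LatticeModels.LatticeGraph

/-!
# Crux `PerturbedXYOrder` (item `stmt-HubbardSuperconductivity-10739`): the low-temperature
hypothesis `J₀ ≤ J` is load-bearing — FALSE without it (standing disprover, cycle 1)

The crux (`Theses.NodalWardXY.PerturbedXYOrder`) is
`∃ J₀ ε a, 0 < ε ∧ 0 < a ∧ ∀ J ≥ J₀ ∀ L ≥ 2 ∀ K admissible, Z_K ≠ 0 ∧ a ≤ Re[num/Z_K/L⁶]`
for the classical XY model on `(ℤ/Lℤ)³` with weight `exp(J Σ_b cos ∇_b θ) · exp(W_K)`.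
This file refutes the variant in which the window `J₀ ≤ J` is dropped (equivalently `J₀` forced
to `-∞`): at infinite temperature `J = 0` with `K = 0` the angles are independent and uniform on
`[0,2π]`, the two-point function `∫ cos(θ_x - θ_y)` vanishes off the diagonal (Fubini on the
product Lebesgue measure) and the plateau equals `L⁻³ → 0`.  Physics-free ("high temperature has
no order"); it certifies that every proof must use `J ≥ J₀` with `J₀` large, and documents the
normalisation `plateau(J = 0, K = 0) = L⁻³` exactly (diagonal terms only).

* `integral_cos_Icc_two_pi`, `integral_sin_Icc_two_pi` — `∫_{[0,2π]} cos = ∫_{[0,2π]} sin = 0`;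
* `setIntegral_cube_cos_sub` — `∫_{[0,2π]^ι} cos(θ_x - θ_y) dθ = 0` for `x ≠ y` (any finite `ι`);
* `perturbedXYOrder_false_without_lowT` — the refutation (body of the crux verbatim, `J₀` removed).
-/

noncomputable section

namespace Summit.HubbardSuperconductivity.HubbardSuperconductivity.Theorems.PerturbedXYOrder.Negative

open MeasureTheory Literature.Probability.LatticeModels Finset

/-- `∫_{[0,2π]} cos = 0`. [folklore] -/
theorem integral_cos_Icc_two_pi : ∫ t in Set.Icc (0:ℝ) (2 * Real.pi), Real.cos t = 0 := by
  rw [integral_Icc_eq_integral_Ioc, ← intervalIntegral.integral_of_le (by positivity),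
    integral_cos]
  simp

/-- `∫_{[0,2π]} sin = 0`. [folklore] -/
theorem integral_sin_Icc_two_pi : ∫ t in Set.Icc (0:ℝ) (2 * Real.pi), Real.sin t = 0 := by
  rw [integral_Icc_eq_integral_Ioc, ← intervalIntegral.integral_of_le (by positivity),
    integral_sin]
  simp

/-- Off-diagonal two-point function of independent uniform angles vanishes:
`∫_{[0,2π]^ι} cos(θ_x - θ_y) dθ = 0` for `x ≠ y` (Fubini for the product Lebesgue measure,
`cos(a-b) = cos a cos b + sin a sin b`). [folklore] -/
theorem setIntegral_cube_cos_sub {ι : Type*} [Fintype ι] [DecidableEq ι] {x y : ι} (hxy : x ≠ y) :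
    ∫ θ in Set.pi Set.univ (fun _ : ι => Set.Icc (0:ℝ) (2 * Real.pi)),
      (Real.cos (θ x - θ y) : ℂ) = 0 := by
  rw [volume_pi, Measure.restrict_pi_pi]
  set ν : Measure ℝ := (volume : Measure ℝ).restrict (Set.Icc (0:ℝ) (2 * Real.pi)) with hν
  obtain ⟨gc, hgc⟩ : ∃ gc : ι → ℝ → ℂ, gc = fun i t =>
      (if i = x then (Real.cos t : ℂ) else 1) * (if i = y then (Real.cos t : ℂ) else 1) := ⟨_, rfl⟩
  obtain ⟨gs, hgs⟩ : ∃ gs : ι → ℝ → ℂ, gs = fun i t =>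
      (if i = x then (Real.sin t : ℂ) else 1) * (if i = y then (Real.sin t : ℂ) else 1) := ⟨_, rfl⟩
  have hprod : ∀ θ : ι → ℝ,
      (Real.cos (θ x - θ y) : ℂ) = (∏ i, gc i (θ i)) + ∏ i, gs i (θ i) := by
    intro θ
    simp only [hgc, hgs, Finset.prod_mul_distrib, Finset.prod_ite_eq', Finset.mem_univ, if_true]
    rw [Real.cos_sub]; push_cast; ring
  have hcont : ∀ i, Continuous (gc i) ∧ Continuous (gs i) := by
    intro i
    rw [hgc, hgs]
    constructor
    · refine Continuous.mul ?_ ?_ <;>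
        exact continuous_if_const _ (fun _ => by fun_prop) (fun _ => by fun_prop)
    · refine Continuous.mul ?_ ?_ <;>
        exact continuous_if_const _ (fun _ => by fun_prop) (fun _ => by fun_prop)
  have hic : ∀ i, Integrable (gc i) ν := fun i => (hcont i).1.integrableOn_Icc
  have his : ∀ i, Integrable (gs i) ν := fun i => (hcont i).2.integrableOn_Icc
  have hcx : ∫ t, gc x t ∂ν = 0 := by
    simp only [hgc, if_true, if_neg hxy, mul_one]
    rw [integral_complex_ofReal, hν, integral_cos_Icc_two_pi]; simp
  have hsx : ∫ t, gs x t ∂ν = 0 := by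
    simp only [hgs, if_true, if_neg hxy, mul_one]
    rw [integral_complex_ofReal, hν, integral_sin_Icc_two_pi]; simp
  calc ∫ θ, (Real.cos (θ x - θ y) : ℂ) ∂Measure.pi (fun _ : ι => ν)
      = ∫ θ, ((∏ i, gc i (θ i)) + ∏ i, gs i (θ i)) ∂Measure.pi (fun _ : ι => ν) := by
        simp_rw [hprod]
    _ = (∫ θ, ∏ i, gc i (θ i) ∂Measure.pi (fun _ : ι => ν))
        + ∫ θ, ∏ i, gs i (θ i) ∂Measure.pi (fun _ : ι => ν) :=
        integral_add (Integrable.fintype_prod hic) (Integrable.fintype_prod his)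
    _ = (∏ i, ∫ t, gc i t ∂ν) + ∏ i, ∫ t, gs i t ∂ν := by
        rw [integral_fintype_prod_eq_prod gc, integral_fintype_prod_eq_prod gs]
    _ = 0 := by
        rw [Finset.prod_eq_zero (Finset.mem_univ x) hcx, Finset.prod_eq_zero (Finset.mem_univ x) hsx,
          add_zero]

/-- The cube `[0,2π]^ι` has positive finite volume, so `∫_{cube} 1 = (2π)^{|ι|} ≠ 0` (we only use
`≠ 0`). [folklore] -/
theorem setIntegral_cube_one_ne_zero {ι : Type*} [Fintype ι] :
    (∫ _θ in Set.pi Set.univ (fun _ : ι => Set.Icc (0:ℝ) (2 * Real.pi)), (1 : ℂ)) ≠ 0 := by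
  rw [integral_const, measureReal_restrict_apply_univ, Complex.real_smul, mul_one, Ne,
    Complex.ofReal_eq_zero, measureReal_def, ENNReal.toReal_eq_zero_iff, not_or]
  constructor
  · rw [volume_pi_pi]
    refine Finset.prod_ne_zero_iff.2 fun i _ => ?_
    rw [Real.volume_Icc]
    exact (ENNReal.ofReal_pos.2 (by linarith [Real.pi_pos])).ne'
  · exact ((isCompact_univ_pi fun _ => isCompact_Icc).measure_lt_top).ne

/-- **FALSE without the low-temperature window.** The crux `PerturbedXYOrder` with `∃ J₀ …
∀ J, J₀ ≤ J →` replaced by `∀ J` (body otherwise verbatim): refuted at `J = 0`, `K = 0`,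
`L = max 2 (⌈1/a⌉₊ + 1)`, where `Z = (2π)^{L³} ≠ 0` but the plateau is exactly `L⁻³ < a`
(independent uniform angles: only the `L³` diagonal terms of `Σ_{x,y} ∫ cos(θ_x - θ_y)` survive).
So `J ≥ J₀` (large) is load-bearing for conjunct 2; on paper it is load-bearing for conjunct 1 as
well (Fisher-type zeros of the imaginary diagonal kernel pinch `K = 0` at `J = J_c`; see the
disprover's workfile `Cruxes/PerturbedXYOrder/Disproof.lean` §2). [folklore] -/
theorem perturbedXYOrder_false_without_lowT :
    ¬ (∃ ε a : ℝ, 0 < ε ∧ 0 < a ∧ ∀ J : ℝ, ∀ (L : ℕ) [NeZero L], 2 ≤ L → ∀ K : (Literature.Probability.LatticeModels.TorusSite 3 L × Fin 3) → (Literature.Probability.LatticeModels.TorusSite 3 L × Fin 3) → ℂ, (∀ b b', ‖K b b'‖ ≤ ε / (1 + ((Literature.Probability.LatticeModels.torusGraph 3 L).dist b.1 b'.1 : ℝ)) ^ 4) → let cube : Set (Literature.Probability.LatticeModels.TorusSite 3 L → ℝ) := Set.pi Set.univ (fun _ => Set.Icc (0:ℝ) (2 * Real.pi)); let cur : (Literature.Probability.LatticeModels.TorusSite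 3 L × Fin 3) → (Literature.Probability.LatticeModels.TorusSite 3 L → ℝ) → ℝ := fun b θ => Real.sin (θ (b.1 + Pi.single b.2 1) - θ b.1); let wJ : (Literature.Probability.LatticeModels.TorusSite 3 L → ℝ) → ℂ := fun θ => ((Real.exp (J * ∑ b : Literature.Probability.LatticeModels.TorusSite 3 L × Fin 3, Real.cos (θ (b.1 + Pi.single b.2 1) - θ b.1)) : ℝ) : ℂ); let W : (Literature.Probability.LatticeModels.TorusSite 3 L → ℝ) → ℂ := fun θ => ∑ b, ∑ b', K b b' * (cur b θ : ℂ) * (cur b' θ : ℂ); let Z : ℂ := MeasureTheory.integral (MeasureTheory.volume.restrict cube) (fun θ => wJ θ * Complex.exp (W θ)); Z ≠ 0 ∧ a ≤ ((∑ x : Literature.Probability.LatticeModels.TorusSite 3 L, ∑ y : Literature.Probability.LatticeModels.TorusSite 3 L, MeasureTheory.integral (MeasureTheory.volume.restrict cube) (fun θ => (Real.cos (θ x - θ y) : ℂ) * (wJ θ * Complex.exp (W θ)))) / Z / ((L : ℂ) ^ 6)).re) := by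
  rintro ⟨ε, a, hε, ha, h⟩
  -- the witness volume
  set L : ℕ := max 2 (⌈1 / a⌉₊ + 1) with hL
  have hL2 : 2 ≤ L := le_max_left _ _
  haveI : NeZero L := ⟨by omega⟩
  have hLpos : (0:ℝ) < L := by exact_mod_cast (show 0 < L by omega)
  have hLa : 1 / (L : ℝ) ^ 3 < a := by
    have h1 : 1 / a < (L : ℝ) := by
      have : (⌈1 / a⌉₊ + 1 : ℕ) ≤ L := le_max_right _ _
      have h2 : ((⌈1 / a⌉₊ + 1 : ℕ) : ℝ) ≤ (L : ℝ) := by exact_mod_cast this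
      push_cast at h2
      linarith [Nat.le_ceil (1 / a)]
    have h1L : (1:ℝ) ≤ L := by exact_mod_cast (show 1 ≤ L by omega)
    have hLL : (L : ℝ) ≤ (L : ℝ) ^ 3 := by
      have h0 : 0 ≤ (L : ℝ) * ((L : ℝ) - 1) * ((L : ℝ) + 1) :=
        mul_nonneg (mul_nonneg hLpos.le (sub_nonneg.2 h1L)) (by linarith)
      nlinarith [h0]
    calc 1 / (L : ℝ) ^ 3 ≤ 1 / (L : ℝ) := div_le_div_of_nonneg_left zero_le_one hLpos hLL
      _ < a := by rw [div_lt_iff₀ hLpos]; rw [div_lt_iff₀ ha] at h1; linarith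
  -- specialise at J = 0, K = 0
  have hK : ∀ b b' : TorusSite 3 L × Fin 3, ‖(fun _ _ => (0:ℂ)) b b'‖ ≤
      ε / (1 + ((torusGraph 3 L).dist b.1 b'.1 : ℝ)) ^ 4 := by
    intro b b'
    simp only [norm_zero]
    positivity
  have key := (h 0 L hL2 (fun _ _ => 0) hK).2
  simp only [zero_mul, Finset.sum_const_zero, Complex.exp_zero, mul_one, Real.exp_zero,
    Complex.ofReal_one] at key
  -- the off-diagonal integrals vanish, the diagonal ones equal the volume
  set V : ℂ := ∫ _θ in Set.pi Set.univ (fun _ : TorusSite 3 L => Set.Icc (0:ℝ) (2 * Real.pi)),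
    (1 : ℂ) with hV
  have hVne : V ≠ 0 := setIntegral_cube_one_ne_zero
  have hsum : ∀ x : TorusSite 3 L,
      ∑ y : TorusSite 3 L, ∫ θ in Set.pi Set.univ (fun _ : TorusSite 3 L => Set.Icc (0:ℝ) (2 * Real.pi)),
        (Real.cos (θ x - θ y) : ℂ) = V := by
    intro x
    rw [Finset.sum_eq_single x]
    · simp [hV]
    · intro y _ hyx
      exact setIntegral_cube_cos_sub (Ne.symm hyx)
    · intro hx; exact absurd (Finset.mem_univ x) hx
  simp only [hsum, Finset.sum_const, Finset.card_univ, nsmul_eq_mul] at key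
  have hcard : (Fintype.card (TorusSite 3 L) : ℂ) = (L : ℂ) ^ 3 := by
    rw [Fintype.card_fun, ZMod.card, Fintype.card_fin]; push_cast; ring
  rw [hcard, mul_div_assoc, div_self hVne, mul_one] at key
  have hval : ((L : ℂ) ^ 3 / (L : ℂ) ^ 6).re = 1 / (L : ℝ) ^ 3 := by
    have hLc : (L : ℂ) ≠ 0 := by exact_mod_cast (show L ≠ 0 by omega)
    rw [show (L : ℂ) ^ 3 / (L : ℂ) ^ 6 = ((1 / (L : ℝ) ^ 3 : ℝ) : ℂ) by
      push_cast; field_simp]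
    exact Complex.ofReal_re _
  rw [hval] at key
  exact absurd key (not_le.2 hLa)

end Summit.HubbardSuperconductivity.HubbardSuperconductivity.Theorems.PerturbedXYOrder.Negative
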